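import Literature.NumberTheory.Automorphic.ResGL2BorelCohomologyFinite
import Literature.NumberTheory.Automorphic.ResGL2BorelEigenvalueFactorisation
import Literature.NumberTheory.Automorphic.ResGLnCentralEigensystem
import HarnessLib

/-!
# The Eisenstein half of Harder's dichotomy for `Res_{F/ℚ} GL₂`, reduced to the torus eigensystem

Topic `NumberTheory/Automorphic`; namespace `Literature.NumberTheory.Automorphic`, grouping
sub-namespace `ResGLnCohomology`.  An auxiliary definition with body and theorems (no named fact,
no `sorry`), continuing `ResGL2BorelReduction`, `ResGL2BorelEigenvalueFactorisation`,
`ResGLnCentralEigensystem` and `ResGL2BorelCohomologyFinite` under the named fact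
`ResGLnCohomology.Harder1987_eigensystem_cuspidalOrEisenstein`.

* `isGrossencharakter_borelPosCentralEigensystem` — on the Borel stratum
  `H^q(B(K)⁺, Fun(GL₂(𝔸_K^∞)/K_f(𝔫), E_λ))` (any number field `K`) the eigenvalues `a_{w,2}` of the
  central operators `T_{w,2} = T_{ϖ_w · 1}` on a non-zero class form, through `ι : E ≃+* ℂ`, an algebraic
  Größencharakter (`TwistedCentralEigensystem.isGrossencharakter_centralEigensystem_of_types` for the
  datum `Γ = B(K)⁺`: the scalars `x · 1 ∈ B(K)⁺` are central and act on `E_λ` by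
  `ω_λ(x) = ∏_τ τ(x)^{n·lowest(λ_τ) + deg(λ_τ)}`) [cite: Harder1987, §2.6 Thm. 1];
* `Harder1987_eigensystem_cuspidalOrEisenstein_of_interior_of_torusChar` — **the named fact follows
  from (I) its restriction to interior classes and (T) the statement that the `T^B_{diag(1,ϖ_w)}`-
  eigenvalues `μ_w` of a non-zero common eigenvector of the Borel model over a totally real field form an
  algebraic Größencharakter** (Harder's computation of the torus action on `H^•(Γ ∩ U, E_λ)`,
  [cite: Harder1987, §2, (2.3)–(2.9) and §2.6 Thm. 1]): by the dichotomy
  (`Harder1987_eigensystem_cuspidalOrEisenstein_of_interior_of_borel`), the finite-dimensionality of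
  the stratum (`finiteDimensional_borelPosCohomology`), the eigenvalue factorisation
  `a_{w,1} = N(w) ζ_w μ_w⁻¹ + μ_w`, `a_{w,2} = ζ_w` (`exists_borelPos_eigenvalue_factorisation`), the
  central eigensystem (`isGrossencharakter_borelPosCentralEigensystem`), the norm character
  (`isGrossencharakter_absNorm'`) and the closing algebra (`eisensteinClause_of_factorisation`).

Both hypotheses are spelled out; no new named fact is introduced.

## References

* G. Harder, *Eisenstein cohomology of arithmetic groups. The case GL₂*, Invent. Math. 89 (1987),
  §1, §2 (2.3)–(2.9), §2.6 Thm. 1, §3. [Harder1987]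
-/

noncomputable section

open scoped Classical NumberField ComplexConjugate
open NumberField IsDedekindDomain CategoryTheory

namespace Literature.NumberTheory.Automorphic

namespace ResGLnCohomology

open ParallelWeight (borel scalar_mem_borel conductorOf conductorOf_ne_bot)
open BigHeckeGLn Literature.NumberTheory.GaloisRepresentations

variable {E : Type} [Field E] {K : Type} [Field K] [NumberField K]

/-! ### The central eigensystem on the Borel stratum -/

/-- The central scalars `x · 1 ∈ B(K)⁺` (`x ∈ Kˣ`; determinant `x²` is totally positive).
[folklore] -/
abbrev zBorel (x : Kˣ) : borelPos K :=
  ⟨zScalar x, (mem_borelPos_iff_coe_mem_borel _).2 (scalar_mem_borel K x)⟩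

omit [NumberField K] in
/-- The central scalars are central in `B(K)⁺`. [folklore] -/
theorem zBorel_mem_center (x : Kˣ) : zBorel x ∈ Subgroup.center (borelPos K) := by
  rw [Subgroup.mem_center_iff]
  intro γ
  exact Subtype.ext (Subgroup.mem_center_iff.1 (zScalar_mem_center x) γ)

/-- **The `T_{w,2}`-eigenvalues on the Borel stratum form an algebraic Größencharakter.**  For a
non-zero `y ∈ H^q(B(K)⁺, Fun(GL₂(𝔸_K^∞)/K_f(𝔫), E_λ))` (`𝔫 ≠ 0`) with `T_{w,2} y = a_w y` for all
`w ∉ S` (`S` finite), `w ↦ ι(a_w)` is an algebraic Größencharakter modulo `𝔫 ∏_{w ∈ S} w` of the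
infinity type of `ω_λ` (`ResGLnCentralEigensystem`). [cite: Harder1987, §2.6 Thm. 1] -/
theorem isGrossencharakter_borelPosCentralEigensystem (ι : E ≃+* ℂ) {𝔫 : Ideal (𝓞 K)} (h𝔫 : 𝔫 ≠ 0)
    {lam : (K →+* E) → Fin 2 → ℤ} {q : ℕ} {S : Set (HeightOneSpectrum (𝓞 K))} (hS : S.Finite)
    {y : borelPosCohomology E K 𝔫 lam q} (hy : y ≠ 0) (a : HeightOneSpectrum (𝓞 K) → E)
    (heig : ∀ w, w ∉ S → borelPosHeckeT E K 𝔫 lam q w 2 y = a w • y) :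
    IsGrossencharakter (conductorOf (F := K) 𝔫 hS) (fun w => centralExponentAt ι lam w.embedding)
      (fun w => ((w.mult - 1 : ℕ) : ℤ) * centralExponentAt ι lam (ComplexEmbedding.conjugate w.embedding))
      (fun w => ι (a w)) := by
  haveI : CharZero E := ι.toRingHom.charZero
  exact TwistedQuotient.isGrossencharakter_centralEigensystem_of_types (V := CoeffModule E 2 K lam)
    ((diagPos 2 K).comp (borelPos K).subtype) (level 2 K 𝔫)
    ((coeffRepPos E 2 K lam).comp (borelPos K).subtype) q ι h𝔫 le_rfl hS hy a heig
    (fun x => zBorel x) (fun x => zBorel_mem_center x) (fun x => diagPos_zScalar x)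
    (fun x => centralWeight E 2 K lam x) (fun x v => coeffRepPos_zScalar E lam x v) _ _
    (fun x => map_centralWeight ι lam x)

/-! ### The reduction of the named fact to the interior half and the torus eigensystem -/

/-- **Harder's dichotomy, Eisenstein half discharged up to the torus eigensystem.**  The named fact
`Harder1987_eigensystem_cuspidalOrEisenstein` follows from
(I) its restriction to INTERIOR classes `c ∈ H^q_!(S_{K_f(𝔫)}, Ẽ_λ)` [cite: Harder1987, §3.1
(3.1.1)–(3.1.4), §3.2 Prop. 3.2.4 and (3.2.5)], and
(T) for `F` totally real, `E` algebraically closed of characteristic `0` with `ι : E ≃+* ℂ`, `𝔫 ≠ 0`: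
the eigenvalues `μ_w ≠ 0` (`w ∤ 𝔫`) of the operators `T^B_{diag(1,ϖ_w)}` on a non-zero common
eigenvector `y₀` of the Borel model `H^q(B(F)⁺, Fun(H_S ⧸ (K_f(𝔫) ∩ H_S), E_λ))` form, through `ι`, an
algebraic Größencharakter [cite: Harder1987, §2, (2.3)–(2.9), §2.6 Thm. 1 (p. 56)].
Everything else of the Eisenstein half is proved in the tree: the dichotomy and the passage to the
stratum (`ResGL2BorelReduction`), the finite-dimensionality of the stratum
(`ResGL2BorelCohomologyFinite`), the factorisation `a_{w,1} = N(w) ζ_w μ_w⁻¹ + μ_w`, `a_{w,2} = ζ_w`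
(`ResGL2BorelEigenvalueFactorisation`), the central eigensystem `a_{w,2}` and the norm as
Größencharaktere, and the closing algebra `ψ₁ = N ζ μ⁻¹`, `ψ₂ = μ`.
[cite: Harder1987, §1, §2.6 Thm. 1, §3, §4.2 Thm. 2] -/
theorem Harder1987_eigensystem_cuspidalOrEisenstein_of_interior_of_torusChar
    (hI : ∀ (F : Type) [Field F] [NumberField F], NumberField.IsTotallyReal F →
      ∀ (hcpt : isCompact_glFiniteIntegralLevel 2 F) (E : Type) [Field E] (ι : E ≃+* ℂ)
        (𝔫 : Ideal (𝓞 F)), 𝔫 ≠ 0 →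
      ∀ (lam : (F →+* E) → Fin 2 → ℤ) (q : ℕ) (c : levelCohomology E 2 F 𝔫 lam q),
        c ∈ interiorLevelCohomology E 2 F 𝔫 lam q → c ≠ 0 →
      ∀ (a : HeightOneSpectrum (𝓞 F) → ℕ → E),
        (∀ᶠ w in Filter.cofinite, heckeT E 2 F 𝔫 lam q w 1 c = a w 1 • c ∧
          heckeT E 2 F 𝔫 lam q w 2 c = a w 2 • c) →
        (∃ π₀ : CuspidalAutomorphicRepData 2 F hcpt, π₀.1.IsRegularAlgebraic ∧
          ∀ᶠ w in Filter.cofinite, ∃ α : Multiset ℂ, π₀.1.HasSatakeParamAt w α ∧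
            ι (a w 1) = ((Real.sqrt (w.residueCard : ℝ) : ℝ) : ℂ) * α.esymm 1 ∧
              ι (a w 2) = α.esymm 2) ∨
        (∃ (𝔣 : Ideal (𝓞 F)) (p₁ q₁ p₂ q₂ : InfinitePlace F → ℤ)
            (ψ₁ ψ₂ : HeightOneSpectrum (𝓞 F) → ℂ),
          𝔣 ≠ ⊥ ∧ IsGrossencharakter 𝔣 p₁ q₁ ψ₁ ∧ IsGrossencharakter 𝔣 p₂ q₂ ψ₂ ∧
          ∀ᶠ w in Filter.cofinite, ι (a w 1) = ψ₁ w + ψ₂ w ∧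
            ((Ideal.absNorm w.asIdeal : ℕ) : ℂ) * ι (a w 2) = ψ₁ w * ψ₂ w))
    (hT : ∀ (F : Type) [Field F] [NumberField F], NumberField.IsTotallyReal F →
      ∀ (E : Type) [Field E] [IsAlgClosed E] [CharZero E] (ι : E ≃+* ℂ) (𝔫 : Ideal (𝓞 F)), 𝔫 ≠ 0 →
      ∀ (lam : (F →+* E) → Fin 2 → ℤ) (q : ℕ) (y₀ : borelPosModelCohomology E F 𝔫 lam q)
        (μ : HeightOneSpectrum (𝓞 F) → E), y₀ ≠ 0 →
        (∀ w : HeightOneSpectrum (𝓞 F), ¬ w.asIdeal ∣ 𝔫 →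
          borelPosModelHecke E F 𝔫 lam q (borelHeckeElement₂ _ w) y₀ = μ w • y₀ ∧ μ w ≠ 0) →
        ∃ (𝔣 : Ideal (𝓞 F)) (p q' : InfinitePlace F → ℤ), 𝔣 ≠ ⊥ ∧
          IsGrossencharakter 𝔣 p q' (fun w => ι (μ w))) :
    Harder1987_eigensystem_cuspidalOrEisenstein := by
  refine Harder1987_eigensystem_cuspidalOrEisenstein_of_interior_of_borel hI ?_
  intro F _ _ hF E _ ι 𝔫 h𝔫 lam q y hy a ha
  haveI : CharZero E := ι.toRingHom.charZero
  haveI : IsAlgClosed E := IsAlgClosed.of_ringEquiv ℂ E ι.symm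
  haveI := finiteDimensional_borelPosCohomology E h𝔫 lam q
  -- the factorisation on the Borel model
  obtain ⟨y₀, μ, ζ, hy₀, hμζ, hfac⟩ := exists_borelPos_eigenvalue_factorisation h𝔫 q hy a ha
  -- the central eigensystem `a_{w,2}` is a Größencharakter
  have hS : Set.Finite {w : HeightOneSpectrum (𝓞 F) |
      ¬ (borelPosHeckeT E F 𝔫 lam q w 1 y = a w 1 • y ∧ borelPosHeckeT E F 𝔫 lam q w 2 y = a w 2 • y)} :=
    Filter.eventually_cofinite.1 ha
  have hζ := isGrossencharakter_borelPosCentralEigensystem ι h𝔫 hS hy (fun w => a w 2)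
    fun w hw => (Classical.not_not.1 hw).2
  -- the torus eigensystem `μ` is a Größencharakter (hypothesis (T))
  obtain ⟨𝔣μ, pμ, qμ, h𝔣μ, hμ⟩ := hT F hF E ι 𝔫 h𝔫 lam q y₀ μ hy₀
    fun w hw => ⟨(hμζ w hw).1, (hμζ w hw).2.2⟩
  -- the factorisation with `ζ` replaced by `a_{w,2}`
  have hfac' : ∀ᶠ w in Filter.cofinite,
      a w 1 = (Ideal.absNorm w.asIdeal : E) * a w 2 * (μ w)⁻¹ + μ w ∧ a w 2 = a w 2 :=
    hfac.mono fun w hw => ⟨by rw [hw.2]; exact hw.1, rfl⟩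
  have h𝔫' : 𝔫 ≠ ⊥ := by simpa using h𝔫
  exact eisensteinClause_of_factorisation ι hfac' h𝔣μ (conductorOf_ne_bot h𝔫 hS) h𝔫' hμ hζ
    (isGrossencharakter_absNorm' 𝔫)

end ResGLnCohomology

end Literature.NumberTheory.Automorphic

end
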